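import Summits.QuantumFields.YangMills.Theorems.LuscherReductionTwistedTraceScalingTwoLoopFlow
import Literature.MathematicalPhysics.QuantumFieldTheory.Balaban1983to89.FlowStepRuns
import Literature.MathematicalPhysics.QuantumFieldTheory.Balaban1983to89.B12Beta
import Mathlib.Analysis.SpecificLimits.Basic
import HarnessLib

/-!
# RUN CONTROL for a two-loop flow family (TRACK groundwork; crux `TwistedTraceScaling`, stmt-QuantumFields-20203, line «twolattice» skeleton r3,
# registered stub `stub_labelTracking`): label-free real analysis on the calibrator run `x_n = 1/g_n²`, `g = FlowStepRuns.genSeq φ g₀`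
Route `LuscherReduction` (owner ym-beyond-p1), LEAD ym-lead-20203-twolattice g1.  The hypotheses of the skeleton's `Stmt.twoLoopLawH binf b1inf φ` (one-loop
split `S`; (AF-0r) `|β⁰_k − a| ≤ c₀θ₀^k`; (AF-1) `|β¹_k(p)| ≤ C₁ p_last` on the boxes `]0,γ]^{k+1}`; (TL) `|β¹_k(g_0..g_k) − b1inf g_k²| ≤ C₃g_k³ + c₁θ₁^k`
along box runs) are taken UNPACKED (no dependence on the re-homed vocabulary module).  Proved: §1 `genSeq_step` (one step of (0.20)); §2 `cube_step` (the cubic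
(TL)-remainder telescopes in the coupling: `(a/2)g³ ≤ (g'−g) + 2r g_m³`), `geom_partial_le`; §3 `prefix_mem_box`, `abs_phi_le` (crude step `|φ_n| ≤ a + c₀ + C₁γ`),
`prefix_bounds` (two-loop remainders `e_j = φ_j − a − b1inf g_j²` have `Σ_{j<n}|e_j| ≤ R := G + C₃(4/a)(1+2G)` UNIFORMLY in `n` along box runs);
§4 ★ `run_control` — INDUCTION ON THE SCALE: with floor `X ≥ m + B_c`, `X ≥ 1/g_m² + B_c`, datum `x_0 ≥ X` and the BUDGET
`X ≤ x_0 − aK − κ(log(x_0/X) + C₂ + a/m) − R` (`κ = b1inf/a`; all constants explicit in the family's constants only) the run stays above `X` up to the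
horizon `K`, obeys (0.20), and (tree `TowerFlow.twoLoopFlow_endpoint`) ★ `|x_K − (x_0 − aK − κ log(x_0/x_K))| ≤ κC₂ + R`, uniformly in `K` and in `x_0`.
The label bookkeeping discharging the budget from the femto window, and the registered stub, are the companion module `…TrackStub`.
HONEST FRAMING: elementary real analysis about hypothetical two-loop flow families (W-FLOW for Bałaban's true flow is NOT in print); femto rung R2b1 of a
CONDITIONAL reduction route; nothing here is a claim about Yang–Mills, a gap, or Clay.  No definitions, no new named facts.  (`run_control` needs
`maxHeartbeats 400000`: one long induction step; tree precedent `…TowerE1`.)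
-/

set_option autoImplicit false

noncomputable section

open Real
open scoped BigOperators

namespace Summit.QuantumFields.YangMills.Theorems.FemtoTransferGap.TwoLattice

namespace TowerFlow

open Literature.MathematicalPhysics.QuantumFieldTheory.Balaban1983to89
open Literature.MathematicalPhysics.QuantumFieldTheory.Balaban1983to89.FlowStep
open Literature.MathematicalPhysics.QuantumFieldTheory.Balaban1983to89.FlowStepRuns

/-! ## §1 One step of the generated run -/

/-- One step of (0.20) for the generated run: positivity of `1/g_n² − φ_n` gives `g_{n+1} > 0` and `1/g_{n+1}² = 1/g_n² − φ_n(g_0,…,g_n)`.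
[cite: Balaban1987RG1, (0.20) p.256] -/
theorem genSeq_step (φ : HBeta) (g0 : ℝ) (n : ℕ)
    (hpos : 0 < 1 / genSeq φ g0 n ^ 2 - φ n (prefixOf (genSeq φ g0) n)) :
    0 < genSeq φ g0 (n + 1) ∧
      1 / genSeq φ g0 (n + 1) ^ 2 = 1 / genSeq φ g0 n ^ 2 - φ n (prefixOf (genSeq φ g0) n) := by
  rw [genSeq_succ]
  exact ⟨solveCoupling_pos hpos, inv_sq_solveCoupling hpos⟩

/-! ## §2 Elementary pieces: the cubic remainder telescopes in the coupling; geometric partial sums -/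

/-- One step for the cubic remainder, in the coupling `g = x^{-1/2}` itself: if `1/g² − 1/g'² ≥ a − r` with `0 < g, g' ≤ g_m`, `a > 0`, `r ≥ 0`, then
`(a/2)·g³ ≤ (g' − g) + 2 r g_m³`. [folklore] -/
theorem cube_step {a r g g' gm : ℝ} (ha : 0 < a) (hr : 0 ≤ r) (hg : 0 < g) (hg' : 0 < g') (hgm : g ≤ gm) (hg'm : g' ≤ gm)
    (hd : a - r ≤ 1 / g ^ 2 - 1 / g' ^ 2) : a / 2 * g ^ 3 ≤ (g' - g) + 2 * r * gm ^ 3 := by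
  have hgm0 : 0 < gm := lt_of_lt_of_le hg hgm
  have hg3 : g ^ 3 ≤ gm ^ 3 := pow_le_pow_left₀ hg.le hgm 3
  have hkey : 1 / g ^ 2 - 1 / g' ^ 2 = (g' - g) * (g' + g) / (g ^ 2 * g' ^ 2) := by
    field_simp; ring
  by_cases hle : g ≤ g'
  · -- `x' ≤ x`: `1/g² − 1/g'² ≤ 2(g'−g)/g³`, so `(a − r) g³ ≤ 2 (g' − g)`
    have h1 : (a - r) * g ^ 3 ≤ 2 * (g' - g) := by
      have h2 : a - r ≤ (g' - g) * (g' + g) / (g ^ 2 * g' ^ 2) := by rw [← hkey]; exact hd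
      have hden : 0 < g ^ 2 * g' ^ 2 := by positivity
      rw [le_div_iff₀ hden] at h2
      have h3 : (g' - g) * (g' + g) * g ≤ 2 * (g' - g) * g' ^ 2 := by nlinarith [mul_nonneg (sub_nonneg.2 hle) hg.le, mul_nonneg (sub_nonneg.2 hle) hg'.le]
      nlinarith [mul_le_mul_of_nonneg_right h2 hg.le, pow_pos hg' 2, pow_pos hg 2]
    nlinarith [mul_nonneg hr (pow_nonneg hgm0.le 3), mul_nonneg hr (pow_nonneg hg.le 3)]
  · -- `x' > x`: then `a < r`; `(a/2) g³ ≤ (r/2) gm³` and `g − g' ≤ r gm³`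
    rw [not_le] at hle
    have hneg : 1 / g ^ 2 - 1 / g' ^ 2 < 0 := by
      rw [hkey]; exact div_neg_of_neg_of_pos (by nlinarith) (by positivity)
    have har : a < r := by linarith
    have h1 : a / 2 * g ^ 3 ≤ r / 2 * gm ^ 3 := by nlinarith [pow_nonneg hg.le 3]
    have h2 : g - g' ≤ r * gm ^ 3 := by
      have hden : 0 < g ^ 2 * g' ^ 2 := by positivity
      have h3 : (g - g') * (g + g') / (g ^ 2 * g' ^ 2) ≤ r := by
        have : 1 / g' ^ 2 - 1 / g ^ 2 = (g - g') * (g + g') / (g ^ 2 * g' ^ 2) := by field_simp; ring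
        rw [← this]; linarith
      rw [div_le_iff₀ hden] at h3
      have h4 : (g - g') * (g + g') ≥ (g - g') * g := by nlinarith
      have h5 : (g - g') * g ≤ r * g ^ 2 * g' ^ 2 := by nlinarith
      have h6 : g - g' ≤ r * g * g' ^ 2 := by
        have := div_le_div_of_nonneg_right h5 hg.le
        rwa [mul_div_assoc, div_self hg.ne', mul_one, show r * g ^ 2 * g' ^ 2 / g = r * g * g' ^ 2 by field_simp] at this
      have h7 : r * g * g' ^ 2 ≤ r * gm ^ 3 := by
        have : g * g' ^ 2 ≤ gm ^ 3 := by nlinarith [mul_le_mul hgm (pow_le_pow_left₀ hg'.le hg'm 2) (by positivity) hgm0.le]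
        nlinarith
      linarith
    nlinarith [pow_nonneg hgm0.le 3]

/-- Geometric partial sums: `Σ_{j<n} c θ^j ≤ c/(1 − θ)` for `0 ≤ θ < 1`, `0 ≤ c`. [folklore] -/
theorem geom_partial_le {c θ : ℝ} (hc : 0 ≤ c) (h0 : 0 ≤ θ) (h1 : θ < 1) (n : ℕ) :
    ∑ j ∈ Finset.range n, c * θ ^ j ≤ c / (1 - θ) := by
  have hs : Summable (fun j : ℕ => θ ^ j) := summable_geometric_of_lt_one h0 h1
  have h := Summable.sum_le_tsum (Finset.range n) (fun j _ => pow_nonneg h0 j) hs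
  rw [tsum_geometric_of_lt_one h0 h1] at h
  rw [← Finset.mul_sum, div_eq_mul_inv]
  exact mul_le_mul_of_nonneg_left h hc

/-! ## §3 Run control: helpers -/

/-- A prefix whose entries lie in `]0,γ]` is in the box. [folklore] -/
theorem prefix_mem_box {γ : ℝ} {g : ℕ → ℝ} {j : ℕ} (h : ∀ i, i ≤ j → 0 < g i ∧ g i ≤ γ) :
    prefixOf g j ∈ Box γ j := by
  rw [mem_box]
  intro i
  simpa [prefixOf] using h i (Nat.lt_succ_iff.mp i.isLt)

/-- Crude one-step bound from (AF-0r) and (AF-1): `|φ_n(p)| ≤ a + c₀ + C₁γ` on the box. [cite: Balaban1987RG1, §1 p.264] -/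
theorem abs_phi_le {φ : HBeta} (S : B12Beta.OneLoopSplit φ) {γ a C₁ c₀ θ₀ : ℝ} (ha : 0 < a) (hC₁ : 0 ≤ C₁)
    (hθ₀ : 0 ≤ θ₀) (hθ₀1 : θ₀ < 1)
    (hAF0 : ∀ k : ℕ, |S.β0 k - a| ≤ c₀ * θ₀ ^ k)
    (hAF1 : ∀ (k : ℕ) (p : Fin (k + 1) → ℝ), p ∈ Box γ k → |S.β1 k p| ≤ C₁ * p (Fin.last k))
    (n : ℕ) {p : Fin (n + 1) → ℝ} (hp : p ∈ Box γ n) : |φ n p| ≤ a + c₀ + C₁ * γ := by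
  have hsplit : φ n p = S.β0 n + S.β1 n p := S.split n p
  have h0 : |S.β0 n| ≤ a + c₀ := by
    have h1 : |S.β0 n| ≤ |S.β0 n - a| + |a| := by
      have := abs_add_le (S.β0 n - a) a; rwa [sub_add_cancel] at this
    have h2 : c₀ * θ₀ ^ n ≤ c₀ * 1 := by
      have hc₀ : 0 ≤ c₀ := le_trans (abs_nonneg _) (hAF0 0) |>.trans (by simp)
      exact mul_le_mul_of_nonneg_left (pow_le_one₀ hθ₀ hθ₀1.le) hc₀
    rw [abs_of_pos ha] at h1
    linarith [hAF0 n]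
  have h1 : |S.β1 n p| ≤ C₁ * γ := by
    have hlast := ((mem_box.1 hp) (Fin.last n))
    exact (hAF1 n p hp).trans (mul_le_mul_of_nonneg_left hlast.2 hC₁)
  rw [hsplit]
  exact (abs_add_le _ _).trans (by linarith)

/-- **Prefix bounds.**  Along a prefix of the generated run that lies in the box `]0, g_m]` (`g_m ≤ γ`, `g_m ≤ 1`, `2C₃g_m³ ≤ a/4`) and obeys the recursion,
the two-loop remainders `e_j = φ_j − a − b1inf·g_j²` satisfy `|e_j| ≤ c₀θ₀^j + C₃g_j³ + c₁θ₁^j`, the cubic sum is `Σ_{j<n} g_j³ ≤ (4/a)(1 + 2G)` and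
`Σ_{j<n} |e_j| ≤ G + C₃·(4/a)(1+2G)` — UNIFORMLY in `n`. [cite: Rivasseau1991, Lemma II.5.4] -/
theorem prefix_bounds {φ : HBeta} (S : B12Beta.OneLoopSplit φ)
    {γ a b1inf c₀ θ₀ C₃ c₁ θ₁ gm G : ℝ} (ha : 0 < a) (hb1 : 0 ≤ b1inf) (hc₀ : 0 ≤ c₀)
    (hθ₀ : 0 ≤ θ₀) (hθ₀1 : θ₀ < 1) (hC₃ : 0 ≤ C₃) (hc₁ : 0 ≤ c₁) (hθ₁ : 0 ≤ θ₁) (hθ₁1 : θ₁ < 1)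
    (hgm : 0 < gm) (hgmγ : gm ≤ γ) (hgm1 : gm ≤ 1) (hgmC : 2 * C₃ * gm ^ 3 ≤ a / 4) (hG : G = c₀ / (1 - θ₀) + c₁ / (1 - θ₁))
    (hAF0 : ∀ k : ℕ, |S.β0 k - a| ≤ c₀ * θ₀ ^ k)
    (hTL : ∀ (K : ℕ) (gs : ℕ → ℝ), RGEqH K φ gs → (∀ k, k ≤ K → 0 < gs k ∧ gs k ≤ γ) →
      ∀ k, k < K → |S.β1 k (prefixOf gs k) - b1inf * gs k ^ 2| ≤ C₃ * gs k ^ 3 + c₁ * θ₁ ^ k)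
    {g : ℕ → ℝ} (n : ℕ) (hg : ∀ j, j ≤ n → 0 < g j ∧ g j ≤ gm)
    (hid : ∀ j, j < n → 1 / g j ^ 2 - 1 / g (j + 1) ^ 2 = φ j (prefixOf g j)) :
    (∀ j, j < n → |φ j (prefixOf g j) - a - b1inf * g j ^ 2| ≤ c₀ * θ₀ ^ j + C₃ * g j ^ 3 + c₁ * θ₁ ^ j) ∧
    ∑ j ∈ Finset.range n, g j ^ 3 ≤ 4 / a * (1 + 2 * G) ∧
    ∑ j ∈ Finset.range n, |φ j (prefixOf g j) - a - b1inf * g j ^ 2| ≤ G + C₃ * (4 / a * (1 + 2 * G)) := by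
  have hbox : ∀ k, k ≤ n → 0 < g k ∧ g k ≤ γ := fun k hk => ⟨(hg k hk).1, (hg k hk).2.trans hgmγ⟩
  have hRG : RGEqH n φ g := by
    intro k hk
    have := hid k hk
    linarith
  have hTLn := hTL n g hRG hbox
  have he : ∀ j, j < n → |φ j (prefixOf g j) - a - b1inf * g j ^ 2| ≤ c₀ * θ₀ ^ j + C₃ * g j ^ 3 + c₁ * θ₁ ^ j := by
    intro j hj
    have hsplit : φ j (prefixOf g j) = S.β0 j + S.β1 j (prefixOf g j) := S.split j _
    have h1 : φ j (prefixOf g j) - a - b1inf * g j ^ 2 = (S.β0 j - a) + (S.β1 j (prefixOf g j) - b1inf * g j ^ 2) := by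
      rw [hsplit]; ring
    rw [h1]
    calc |(S.β0 j - a) + (S.β1 j (prefixOf g j) - b1inf * g j ^ 2)|
        ≤ |S.β0 j - a| + |S.β1 j (prefixOf g j) - b1inf * g j ^ 2| := abs_add_le _ _
      _ ≤ c₀ * θ₀ ^ j + (C₃ * g j ^ 3 + c₁ * θ₁ ^ j) := add_le_add (hAF0 j) (hTLn j hj)
      _ = c₀ * θ₀ ^ j + C₃ * g j ^ 3 + c₁ * θ₁ ^ j := by ring
  have hgeo0 : ∑ j ∈ Finset.range n, c₀ * θ₀ ^ j ≤ c₀ / (1 - θ₀) := geom_partial_le hc₀ hθ₀ hθ₀1 n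
  have hgeo1 : ∑ j ∈ Finset.range n, c₁ * θ₁ ^ j ≤ c₁ / (1 - θ₁) := geom_partial_le hc₁ hθ₁ hθ₁1 n
  have hG0 : 0 ≤ G := by
    rw [hG]; exact add_nonneg (div_nonneg hc₀ (by linarith)) (div_nonneg hc₁ (by linarith))
  have hcube : ∀ j ∈ Finset.range n,
      a / 2 * g j ^ 3 ≤ (g (j + 1) - g j) + 2 * (c₀ * θ₀ ^ j + C₃ * g j ^ 3 + c₁ * θ₁ ^ j) * gm ^ 3 := by
    intro j hj
    have hj' := Finset.mem_range.1 hj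
    have hgj := hg j hj'.le
    have hgj1 := hg (j + 1) hj'
    have hgj0 : 0 ≤ g j := hgj.1.le
    refine cube_step ha (by positivity) hgj.1 hgj1.1 hgj.2 hgj1.2 ?_
    rw [hid j hj']
    have h1 : φ j (prefixOf g j) = a + b1inf * g j ^ 2 + (φ j (prefixOf g j) - a - b1inf * g j ^ 2) := by ring
    rw [h1]
    have h2 : 0 ≤ b1inf * g j ^ 2 := by positivity
    linarith [neg_abs_le (φ j (prefixOf g j) - a - b1inf * g j ^ 2), he j hj']
  have hsumcube := Finset.sum_le_sum hcube
  rw [Finset.sum_add_distrib, Finset.sum_range_sub (f := fun j => g j)] at hsumcube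
  have hgm3 : gm ^ 3 ≤ 1 := pow_le_one₀ hgm.le hgm1
  have hgn : g n - g 0 ≤ 1 := by linarith [(hg n le_rfl).2, (hg 0 (Nat.zero_le _)).1]
  have hrhs : ∑ j ∈ Finset.range n, 2 * (c₀ * θ₀ ^ j + C₃ * g j ^ 3 + c₁ * θ₁ ^ j) * gm ^ 3 =
      2 * gm ^ 3 * (∑ j ∈ Finset.range n, c₀ * θ₀ ^ j + C₃ * ∑ j ∈ Finset.range n, g j ^ 3 + ∑ j ∈ Finset.range n, c₁ * θ₁ ^ j) := by
    rw [Finset.mul_sum, ← Finset.sum_add_distrib, ← Finset.sum_add_distrib, Finset.mul_sum]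
    refine Finset.sum_congr rfl fun j _ => ?_; ring
  have hlhs : ∑ j ∈ Finset.range n, a / 2 * g j ^ 3 = a / 2 * ∑ j ∈ Finset.range n, g j ^ 3 := by rw [Finset.mul_sum]
  rw [hrhs, hlhs] at hsumcube
  set T : ℝ := ∑ j ∈ Finset.range n, g j ^ 3 with hT
  have hT0 : 0 ≤ T := Finset.sum_nonneg fun j hj => pow_nonneg (hg j (Finset.mem_range.1 hj).le).1.le 3
  have hgm30 : 0 ≤ gm ^ 3 := by positivity
  have hineq : a / 2 * T ≤ 1 + 2 * G + a / 4 * T := by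
    have h1 : ∑ j ∈ Finset.range n, c₀ * θ₀ ^ j + C₃ * T + ∑ j ∈ Finset.range n, c₁ * θ₁ ^ j ≤ G + C₃ * T := by
      rw [hG]; linarith
    have h2 : 2 * gm ^ 3 * (∑ j ∈ Finset.range n, c₀ * θ₀ ^ j + C₃ * T + ∑ j ∈ Finset.range n, c₁ * θ₁ ^ j) ≤
        2 * gm ^ 3 * (G + C₃ * T) := mul_le_mul_of_nonneg_left h1 (by positivity)
    have h3 : 2 * gm ^ 3 * (G + C₃ * T) = 2 * gm ^ 3 * G + 2 * C₃ * gm ^ 3 * T := by ring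
    have h4 : 2 * gm ^ 3 * G ≤ 2 * G := by nlinarith
    have h5 : 2 * C₃ * gm ^ 3 * T ≤ a / 4 * T := mul_le_mul_of_nonneg_right hgmC hT0
    linarith
  have hTle : T ≤ 4 / a * (1 + 2 * G) := by
    rw [div_mul_eq_mul_div, le_div_iff₀ ha]
    linarith
  refine ⟨he, hTle, ?_⟩
  calc ∑ j ∈ Finset.range n, |φ j (prefixOf g j) - a - b1inf * g j ^ 2|
      ≤ ∑ j ∈ Finset.range n, (c₀ * θ₀ ^ j + C₃ * g j ^ 3 + c₁ * θ₁ ^ j) :=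
        Finset.sum_le_sum fun j hj => he j (Finset.mem_range.1 hj)
    _ = ∑ j ∈ Finset.range n, c₀ * θ₀ ^ j + C₃ * T + ∑ j ∈ Finset.range n, c₁ * θ₁ ^ j := by
        rw [Finset.sum_add_distrib, Finset.sum_add_distrib, Finset.mul_sum]
    _ ≤ G + C₃ * (4 / a * (1 + 2 * G)) := by
        have hGge : ∑ j ∈ Finset.range n, c₀ * θ₀ ^ j + ∑ j ∈ Finset.range n, c₁ * θ₁ ^ j ≤ G := by rw [hG]; linarith
        have := mul_le_mul_of_nonneg_left hTle hC₃
        linarith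

/-! ## §4 ★ Run control: the induction on the scale and the two-loop endpoint -/

set_option maxHeartbeats 400000 in
/-- ★ **RUN CONTROL.**  Unpacked `twoLoopLawH`-hypotheses on the family `φ` (one-loop split `S`; (AF-0r), (AF-1), (TL) along box runs) with one-loop step
`a > 0` and two-loop step `b1inf ≥ 0`; derived constants `κ = b1inf/a`, `G` (geometric budget), `g_m` (coupling cap), `R` (remainder budget), `m` (analysis
floor, `a + κa + R ≤ m/2`), `B_c` (crude step), `C₂` (Riemann-sum constant) — all functions of the family's constants ONLY.  If the floor `X` satisfies
`X ≥ m + B_c`, `X ≥ 1/g_m² + B_c`, the datum `x_0 = 1/g₀² ≥ X`, and the BUDGET `X ≤ x_0 − aK − κ(log(x_0/X) + C₂ + a/m) − R` holds, then the generated run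
stays above `X` up to the horizon `K`, obeys (0.20), and its endpoint satisfies the two-loop estimate `|x_K − (x_0 − aK − κ log(x_0/x_K))| ≤ κC₂ + R`.
[cite: Balaban1987RG1, (0.20) p.256, Thm 2 p.259] [cite: Rivasseau1991, Lemma II.5.4] -/
theorem run_control {φ : HBeta} (S : B12Beta.OneLoopSplit φ)
    {γ a b1inf C₁ c₀ θ₀ C₃ c₁ θ₁ : ℝ} (hγ : 0 < γ) (ha : 0 < a) (hb1 : 0 ≤ b1inf) (hC₁ : 0 ≤ C₁) (hc₀ : 0 ≤ c₀)
    (hθ₀ : 0 ≤ θ₀) (hθ₀1 : θ₀ < 1) (hC₃ : 0 ≤ C₃) (hc₁ : 0 ≤ c₁) (hθ₁ : 0 ≤ θ₁) (hθ₁1 : θ₁ < 1)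
    (hAF0 : ∀ k : ℕ, |S.β0 k - a| ≤ c₀ * θ₀ ^ k)
    (hAF1 : ∀ (k : ℕ) (p : Fin (k + 1) → ℝ), p ∈ Box γ k → |S.β1 k p| ≤ C₁ * p (Fin.last k))
    (hTL : ∀ (K : ℕ) (gs : ℕ → ℝ), RGEqH K φ gs → (∀ k, k ≤ K → 0 < gs k ∧ gs k ≤ γ) →
      ∀ k, k < K → |S.β1 k (prefixOf gs k) - b1inf * gs k ^ 2| ≤ C₃ * gs k ^ 3 + c₁ * θ₁ ^ k)
    {κ G gm R m Bc C₂ : ℝ}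
    (hκ : κ = b1inf / a) (hG : G = c₀ / (1 - θ₀) + c₁ / (1 - θ₁))
    (hgm : gm = min (min γ 1) (a / (8 * (C₃ + 1))))
    (hR : R = G + C₃ * (4 / a * (1 + 2 * G)))
    (hm : m = max 1 (2 * (a + b1inf + R))) (hBc : Bc = a + c₀ + C₁ * γ)
    (hC₂ : C₂ = (κ * a + m ^ 2 / 2) * ((1 / m + 2 * R / m ^ 2) / a) + R / m)
    {g0 X : ℝ} {K : ℕ} (hg0 : 0 < g0)
    (hXm : m + Bc ≤ X) (hXbox : 1 / gm ^ 2 + Bc ≤ X) (hx0 : X ≤ 1 / g0 ^ 2)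
    (hbud : X ≤ 1 / g0 ^ 2 - a * K - κ * (Real.log ((1 / g0 ^ 2) / X) + C₂ + a / m) - R) :
    (∀ n, n ≤ K → 0 < genSeq φ g0 n ∧ X ≤ 1 / genSeq φ g0 n ^ 2) ∧
    (∀ n, n < K → 1 / genSeq φ g0 n ^ 2 - 1 / genSeq φ g0 (n + 1) ^ 2 = φ n (prefixOf (genSeq φ g0) n)) ∧
    |1 / genSeq φ g0 K ^ 2 - (1 / g0 ^ 2 - a * K - κ * Real.log ((1 / g0 ^ 2) / (1 / genSeq φ g0 K ^ 2)))| ≤ κ * C₂ + R := by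
  generalize hg : genSeq φ g0 = g
  have hκ0 : 0 ≤ κ := by rw [hκ]; positivity
  have hκa : κ * a = b1inf := by rw [hκ]; field_simp
  have hG0 : 0 ≤ G := by rw [hG]; exact add_nonneg (div_nonneg hc₀ (by linarith)) (div_nonneg hc₁ (by linarith))
  have hgmpos : 0 < gm := by rw [hgm]; exact lt_min (lt_min hγ one_pos) (by positivity)
  have hgmγ : gm ≤ γ := by rw [hgm]; exact (min_le_left _ _).trans (min_le_left _ _)
  have hgm1 : gm ≤ 1 := by rw [hgm]; exact (min_le_left _ _).trans (min_le_right _ _)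
  have hgmC : 2 * C₃ * gm ^ 3 ≤ a / 4 := by
    have h1 : gm ≤ a / (8 * (C₃ + 1)) := by rw [hgm]; exact min_le_right _ _
    have h2 : gm ^ 3 ≤ gm := by
      calc gm ^ 3 ≤ gm ^ 1 := pow_le_pow_of_le_one hgmpos.le hgm1 (by norm_num)
        _ = gm := pow_one gm
    have h3 : 2 * C₃ * gm ≤ a / 4 := by
      have : 2 * C₃ * (a / (8 * (C₃ + 1))) ≤ a / 4 := by
        rw [show 2 * C₃ * (a / (8 * (C₃ + 1))) = (C₃ / (C₃ + 1)) * (a / 4) by field_simp; ring]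
        have : C₃ / (C₃ + 1) ≤ 1 := by rw [div_le_one (by positivity)]; linarith
        nlinarith
      nlinarith [mul_le_mul_of_nonneg_left h1 (by positivity : (0 : ℝ) ≤ 2 * C₃)]
    nlinarith [mul_le_mul_of_nonneg_left h2 (by positivity : (0 : ℝ) ≤ 2 * C₃)]
  have hR0 : 0 ≤ R := by rw [hR]; positivity
  have hm1 : 1 ≤ m := by rw [hm]; exact le_max_left _ _
  have hmpos : 0 < m := by linarith
  have hsmall : a + κ * a + R ≤ m / 2 := by rw [hκa, hm]; linarith [le_max_right 1 (2 * (a + b1inf + R))]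
  have hBca : 0 < Bc := by rw [hBc]; positivity
  have hXm' : m ≤ X := by linarith
  have hXpos : 0 < X := by linarith
  have hx0pos : 0 < 1 / g0 ^ 2 := by positivity
  obtain ⟨e, he⟩ : ∃ e : ℕ → ℝ, ∀ j, e j = φ j (prefixOf g j) - a - b1inf * g j ^ 2 := ⟨fun j => _, fun j => rfl⟩
  have hcap : ∀ j, 0 < g j → X - Bc ≤ 1 / g j ^ 2 → g j ≤ gm := by
    intro j hgj hfl
    have h1 : 1 / gm ^ 2 ≤ 1 / g j ^ 2 := by linarith
    exact (pow_le_pow_iff_left₀ hgj.le hgmpos.le two_ne_zero).1 ((one_div_le_one_div (pow_pos hgmpos 2) (pow_pos hgj 2)).1 h1)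
  have main : ∀ n, n ≤ K → (∀ j, j ≤ n → 0 < g j ∧ X ≤ 1 / g j ^ 2) ∧
      (∀ j, j < n → 1 / g j ^ 2 - 1 / g (j + 1) ^ 2 = φ j (prefixOf g j)) := by
    intro n
    induction n with
    | zero =>
      intro _
      refine ⟨fun j hj => ?_, fun j hj => absurd hj (Nat.not_lt_zero _)⟩
      obtain rfl : j = 0 := Nat.le_zero.mp hj
      have : g 0 = g0 := by rw [← hg]; exact genSeq_zero φ g0
      rw [this]
      exact ⟨hg0, hx0⟩
    | succ n ih =>
      intro hn1
      obtain ⟨hfl, hid⟩ := ih (Nat.le_of_succ_le hn1)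
      have hgn : ∀ j, j ≤ n → 0 < g j ∧ g j ≤ gm := fun j hj =>
        ⟨(hfl j hj).1, hcap j (hfl j hj).1 (by linarith [(hfl j hj).2])⟩
      have hboxn : ∀ j, j ≤ n → 0 < g j ∧ g j ≤ γ := fun j hj => ⟨(hgn j hj).1, (hgn j hj).2.trans hgmγ⟩
      have hpbox : prefixOf g n ∈ Box γ n := prefix_mem_box hboxn
      have hcrude : |φ n (prefixOf g n)| ≤ Bc := by
        rw [hBc]; exact abs_phi_le S ha hC₁ hθ₀ hθ₀1 hAF0 hAF1 n hpbox
      have hxn : X ≤ 1 / g n ^ 2 := (hfl n le_rfl).2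
      have hstep_pos : 0 < 1 / g n ^ 2 - φ n (prefixOf g n) := by
        have := (abs_le.1 hcrude).2; linarith only [this, hxn, hXm, hm1]
      obtain ⟨hgn1, hidn⟩ : 0 < g (n + 1) ∧ 1 / g (n + 1) ^ 2 = 1 / g n ^ 2 - φ n (prefixOf g n) := by
        have h := genSeq_step φ g0 n (by rw [hg]; exact hstep_pos)
        rw [hg] at h
        exact h
      have hxn1_crude : X - Bc ≤ 1 / g (n + 1) ^ 2 := by
        rw [hidn]; have := (abs_le.1 hcrude).2; linarith only [this, hxn]
      have hid' : ∀ j, j < n + 1 → 1 / g j ^ 2 - 1 / g (j + 1) ^ 2 = φ j (prefixOf g j) := by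
        intro j hj
        rcases Nat.lt_succ_iff_lt_or_eq.mp hj with hj | rfl
        · exact hid j hj
        · linarith [hidn]
      have hgn' : ∀ j, j ≤ n + 1 → 0 < g j ∧ g j ≤ gm := by
        intro j hj
        rcases Nat.lt_or_eq_of_le hj with hj | rfl
        · exact hgn j (Nat.lt_succ_iff.mp hj)
        · exact ⟨hgn1, hcap _ hgn1 hxn1_crude⟩
      obtain ⟨_, _, hRsum0⟩ := prefix_bounds S ha hb1 hc₀ hθ₀ hθ₀1 hC₃ hc₁ hθ₁ hθ₁1 hgmpos hgmγ hgm1 hgmC hG hAF0 hTL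
        (n + 1) hgn' hid'
      have hRsum : ∑ j ∈ Finset.range (n + 1), |e j| ≤ R := by
        rw [hR]; simpa only [he] using hRsum0
      have hflow : ∀ j, j < n → 1 / g j ^ 2 - 1 / g (j + 1) ^ 2 = a + κ * a / (1 / g j ^ 2) + e j := by
        intro j hj
        rw [hid j hj, he j, div_div_eq_mul_div, div_one, hκa]
        ring
      have hRn : ∑ j ∈ Finset.range n, |e j| ≤ R :=
        le_trans (Finset.sum_le_sum_of_subset_of_nonneg (Finset.range_mono (Nat.le_succ n))
          (fun j _ _ => abs_nonneg (e j))) hRsum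
      have hfloor : ∀ j, j ≤ n → m ≤ 1 / g j ^ 2 := fun j hj => hXm'.trans (hfl j hj).2
      have hlog := abs_log_ratio_sub_sum_le (x := fun j => 1 / g j ^ 2) (e := e) ha hκ0 hm1 hRn hsmall hfloor hflow
      beta_reduce at hlog
      have htel : 1 / g (n + 1) ^ 2 = 1 / g 0 ^ 2 - ∑ j ∈ Finset.range (n + 1), φ j (prefixOf g j) := by
        have h1 := Finset.sum_range_sub' (fun j => 1 / g j ^ 2) (n + 1)
        have h2 : ∑ j ∈ Finset.range (n + 1), (1 / g j ^ 2 - 1 / g (j + 1) ^ 2) =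
            ∑ j ∈ Finset.range (n + 1), φ j (prefixOf g j) := Finset.sum_congr rfl fun j hj => hid' j (Finset.mem_range.1 hj)
        linarith only [h1, h2]
      have hsumφ : ∑ j ∈ Finset.range (n + 1), φ j (prefixOf g j) =
          a * (n + 1) + κ * (∑ j ∈ Finset.range n, a / (1 / g j ^ 2) + a / (1 / g n ^ 2)) + ∑ j ∈ Finset.range (n + 1), e j := by
        have h1 : ∀ j ∈ Finset.range (n + 1), φ j (prefixOf g j) = a + κ * (a / (1 / g j ^ 2)) + e j := by
          intro j _
          rw [he j, div_div_eq_mul_div, div_one, ← hκa]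
          ring
        rw [Finset.sum_congr rfl h1, Finset.sum_add_distrib, Finset.sum_add_distrib, Finset.sum_const, Finset.card_range,
          ← Finset.mul_sum, Finset.sum_range_succ]
        ring
      have hg0eq : g 0 = g0 := by rw [← hg]; exact genSeq_zero φ g0
      have hsumE : ∑ j ∈ Finset.range (n + 1), e j ≤ R := le_trans (Finset.sum_le_sum fun j _ => le_abs_self (e j)) hRsum
      have hRS : ∑ j ∈ Finset.range n, a / (1 / g j ^ 2) ≤ Real.log ((1 / g0 ^ 2) / X) + C₂ := by
        have h1 := (abs_le.1 hlog).1
        have h2 : Real.log ((1 / g 0 ^ 2) / (1 / g n ^ 2)) ≤ Real.log ((1 / g0 ^ 2) / X) := by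
          rw [hg0eq]
          apply Real.log_le_log (div_pos hx0pos (lt_of_lt_of_le hXpos hxn))
          exact div_le_div_of_nonneg_left hx0pos.le hXpos hxn
        rw [hC₂]
        linarith only [h1, h2]
      have hlast : a / (1 / g n ^ 2) ≤ a / m := div_le_div_of_nonneg_left ha.le hmpos (hXm'.trans hxn)
      have hnK : (a : ℝ) * (n + 1) ≤ a * K := by
        have : ((n : ℝ) + 1) ≤ K := by exact_mod_cast hn1
        exact mul_le_mul_of_nonneg_left this ha.le
      have hxn1 : X ≤ 1 / g (n + 1) ^ 2 := by
        rw [htel, hsumφ, hg0eq]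
        have hk1 : κ * (∑ j ∈ Finset.range n, a / (1 / g j ^ 2) + a / (1 / g n ^ 2)) ≤
            κ * (Real.log ((1 / g0 ^ 2) / X) + C₂ + a / m) :=
          mul_le_mul_of_nonneg_left (by linarith only [hRS, hlast]) hκ0
        linarith only [hk1, hbud, hsumE, hnK]
      refine ⟨fun j hj => ?_, hid'⟩
      rcases Nat.lt_or_eq_of_le hj with hj | rfl
      · exact hfl j (Nat.lt_succ_iff.mp hj)
      · exact ⟨hgn1, hxn1⟩
  obtain ⟨hfl, hid⟩ := main K le_rfl
  refine ⟨hfl, hid, ?_⟩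
  have hgK : ∀ j, j ≤ K → 0 < g j ∧ g j ≤ gm := fun j hj =>
    ⟨(hfl j hj).1, hcap j (hfl j hj).1 (by linarith [(hfl j hj).2])⟩
  obtain ⟨_, _, hRsum0⟩ := prefix_bounds S ha hb1 hc₀ hθ₀ hθ₀1 hC₃ hc₁ hθ₁ hθ₁1 hgmpos hgmγ hgm1 hgmC hG hAF0 hTL K hgK hid
  have hRsum : ∑ j ∈ Finset.range K, |e j| ≤ R := by
    rw [hR]; simpa only [he] using hRsum0
  have hflow : ∀ j, j < K → 1 / g j ^ 2 - 1 / g (j + 1) ^ 2 = a + κ * a / (1 / g j ^ 2) + e j := by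
    intro j hj
    rw [hid j hj, he j, div_div_eq_mul_div, div_one, hκa]
    ring
  have hfloor : ∀ j, j ≤ K → m ≤ 1 / g j ^ 2 := fun j hj => hXm'.trans (hfl j hj).2
  have hend := twoLoopFlow_endpoint (x := fun j => 1 / g j ^ 2) (e := e) ha hκ0 hm1 hRsum hsmall hfloor hflow
  beta_reduce at hend
  have hg0eq : g 0 = g0 := by rw [← hg]; exact genSeq_zero φ g0
  rw [hg0eq] at hend
  rw [hC₂]
  exact hend

end TowerFlow

end Summit.QuantumFields.YangMills.Theorems.FemtoTransferGap.TwoLattice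

end
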